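import Summits.ResolutionOfSingularities.ResolutionOfSingularities.Theorems.WeightedInvariantHypersurfaceCentreAssemblyPlusStalk
import HarnessLib

/-!
# Door assembly H2c″, stub [S6] — K4-E (sequel): the GAME-SIDE model of the local rings of `B₊` and the READ-OFF

Route `ResolutionOfSingularities/WeightedInvariant`, crux `Theses.WeightedInvariant.HypersurfaceCentreConstruction`
(stmt-ResolutionOfSingularities-19897), door line `local-engine`, stub [S6] `stub_iotaMax_lt_of_step`; plan of record
`HOME/D/res-D-brk-1/S6-PLAN.md` (sha16 44bfca18104087b1) §K4-E; res-L1-w43-plan-1 RULING gen 9 #2 («089 = K4-E»).  Sequel of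
`…AssemblyPlusStalk.lean` (the chart `φ_U`, K4-E (I)(II)(III), res-type-048's package respelled on `R'.sectionsRing U`):

* `exists_gameSide_stalk_model_of_plusChartFac` (chart version) and **`exists_gameSide_stalk_model`** (chart-free, at a point
  `y'` of `B₊` over an affine `U`, with the assembly dictionaries' model `A' = Localization.AtPrime (U.2.primeIdealOf ⟨σ₊ y', _⟩).asIdeal`):
  a prime `𝔫'` of `extReesAlgebra I'` (`I'ₙ = 𝒥ₙ(U) A'`) off the vertex and over the closed point of `A'`, and a ring isomorphism
  `Ψ : 𝒪_{B₊, y'} ≃+* (extReesAlgebra I')_{𝔫'}` carrying, for every ideal sheaf `K` on `Y`, the stalk of `σˢ(K)|_{B₊}` onto the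
  `t⁻¹`-saturation `⋃ₙ (K(U) · (extReesAlgebra I')_{𝔫'} : (t⁻¹/1)ⁿ)`;
* **`exists_gameSide_readOff`** — for a locally principal strict transform `X'`, `X(U) = (F)` and `B₊ → Spec k` smooth: moreover a
  generator `γ` with `(X'_{y'}) Ψ = (γ) = ⋃ₙ ((F/1) : (t⁻¹/1)ⁿ)`, `O'` regular, `iotaAt ι X' y' = ι(O', γ) = ι(S, e γ)` and
  `y' ∈ singImage X' → e γ ∈ 𝔪_S²` for every further isomorphism `e : O' ≃+* S` of (local) rings.
These are the common inputs of the EXCEPTIONAL half (stub-9) and the TORUS half (res-type-057) of [S6].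
Engineering note (as in the first file): local rings of the glued `B₊` and of `Localization.AtPrime _` over `extReesAlgebra _ =
Algebra.adjoin …` must never have two differently-derived instance paths unified — every step is an application of a lemma whose
instances are either assigned by unification or derived from one `CommRing` binder; no `rw` in goals carrying those types.
Def-free; OURS bookkeeping; no claim about Hironaka's problem. [cite: Wlodarczyk2022, Def. 5.1.1; 3.3.12]
-/

noncomputable section

set_option linter.dupNamespace false -- mandated namespace of this single-conjunct summit

open CategoryTheory AlgebraicGeometry TopologicalSpace IsLocalRing
open scoped LaurentPolynomial
open LaurentPolynomial
open Literature.AlgebraicGeometry.Resolution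
open Summit.ResolutionOfSingularities.ResolutionOfSingularities.Theorems

namespace Summit.ResolutionOfSingularities.ResolutionOfSingularities.Cruxes.HypersurfaceCentreConstruction.LocalEngine

/-! ## The game-side model of the local ring of `B₊` at a point of the chart -/

section GameSideChart

variable {Y : Scheme.{0}} (R' : ReesFiltration Y) (U : Y.affineOpens)
  (φ : (R'.plusChart U : Scheme.{0}) ⟶ (R'.plus : Scheme.{0}))
  (hφ : φ ≫ R'.plus.ι = (R'.plusChart U).ι ≫ R'.openCover.f ⟨U.1, U.2⟩)

include hφ

/-- **K4-E, GAME-SIDE FORM (chart version).**  For a point `φ_U x` of `B₊` over `U = Spec A` (`q` the point of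
`PrimeSpectrum ⊕ 𝒥ₙ(U) tⁿ` under `x`), a localisation `A'` of `A` at a prime `𝔮` with `q ∩ A = 𝔮` (a model of `𝒪_{Y,y}`), and
the localised pieces `I'ₙ = 𝒥ₙ(U) A'`: there are a prime `𝔫'` of the game-side carrier `extReesAlgebra I' = A'[t⁻¹, I'ₙ tⁿ]`
and a ring isomorphism `Ψ : 𝒪_{B₊, φ_U x} ≃+* (extReesAlgebra I')_{𝔫'}` such that, for every ideal sheaf `K` on `Y`, the stalk
of the strict transform `σˢ(K)|_{B₊}` is carried onto the `t⁻¹`-saturation `⋃ₙ (K(U) · (extReesAlgebra I')_{𝔫'} : (t⁻¹/1)ⁿ)`;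
moreover `𝔫'` misses the vertex ideal, lies over `𝔮 A'`, and contains `t⁻¹` iff `q` does (K4-E (I)(II)(III) + res-type-048's
package `exists_prime_extReesAlgebra_ringEquiv_localization_T` + `map_iSup_colon_singleton_pow_of_ringEquiv`).
[cite: Wlodarczyk2022, Def. 5.1.1; 3.3.12] -/
theorem exists_gameSide_stalk_model_of_plusChartFac [IsLocallyNoetherian R'.cobordantBlowup] [IsOpenImmersion φ]
    (x : (R'.plusChart U : Scheme.{0})) (q : PrimeSpectrum (R'.sectionsRing U)) (hq : (R'.plusChart U).ι x = q)
    (𝔮 : Ideal Γ(Y, U)) [𝔮.IsPrime] (h𝔮 : q.asIdeal.comap (algebraMap Γ(Y, U) (R'.sectionsRing U)) = 𝔮)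
    {A' : Type} [CommRing A'] [IsLocalRing A'] [Algebra Γ(Y, U) A'] [IsLocalization.AtPrime A' 𝔮]
    {I' : ℕ → Ideal A'} (hI' : ∀ n, I' n = ((R'.ideal n).ideal U).map (algebraMap Γ(Y, U) A')) :
    ∃ (𝔫' : Ideal (extReesAlgebra I')) (_ : 𝔫'.IsPrime)
      (Ψ : (R'.plus : Scheme.{0}).presheaf.stalk (φ x) ≃+* Localization.AtPrime 𝔫'),
      (∀ K : Y.IdealSheafData,
        (stalkIdeal (R'.strictTransformPlus K) (φ x)).map
            (Ψ : (R'.plus : Scheme.{0}).presheaf.stalk (φ x) →+* Localization.AtPrime 𝔫') =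
          ⨆ n : ℕ, ((((K.ideal U).map (algebraMap Γ(Y, U) A')).map (algebraMap A' (extReesAlgebra I'))).map
            (algebraMap (extReesAlgebra I') (Localization.AtPrime 𝔫'))).colon
            {algebraMap (extReesAlgebra I') (Localization.AtPrime 𝔫') (extReesAlgebra.tInv I') ^ n}) ∧
      ¬ extReesAlgebra.vertexIdeal I' ≤ 𝔫' ∧
      (maximalIdeal A').map (algebraMap A' (extReesAlgebra I')) ≤ 𝔫' ∧
      (extReesAlgebra.tInv I' ∈ 𝔫' ↔
        (⟨T (-1), (R'.filtration U).T_neg_one_mem_extendedRees⟩ : R'.sectionsRing U) ∈ q.asIdeal) := by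
  have hK4 := exists_stalk_ringEquiv_of_plusChartFac R' U φ hφ x q hq
  obtain ⟨Ψ₀, hΨ₀⟩ := hK4
  -- res-type-048's package at the prime `q` of `S = ⊕ 𝒥ₙ(U) tⁿ`, which misses `A ∖ 𝔮`
  have hd : Disjoint ((𝔮.primeCompl.map (algebraMap Γ(Y, U) (R'.sectionsRing U)) :
      Submonoid (R'.sectionsRing U)) : Set (R'.sectionsRing U)) (q.asIdeal : Set (R'.sectionsRing U)) := by
    rw [Set.disjoint_left]
    rintro s ⟨a, ha, rfl⟩ hs
    exact ha (show a ∈ 𝔮 by rw [← h𝔮]; exact hs)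
  have hpk := exists_prime_extReesAlgebra_ringEquiv_localization_T_sectionsRing R' U 𝔮.primeCompl hI' q.asIdeal hd
  obtain ⟨𝔫', h𝔫', g, hgbase, hgT, hgvert, hgprime, hgtInv⟩ := hpk
  -- the structure maps `A → (extReesAlgebra I')_{𝔫'}` through `S_q` and through `A'` agree
  have hcomp : ((g : Localization.AtPrime q.asIdeal →+* Localization.AtPrime 𝔫').comp
      (algebraMap (R'.sectionsRing U) (Localization.AtPrime q.asIdeal))).comp
        (algebraMap Γ(Y, U) (R'.sectionsRing U)) =
      ((algebraMap (extReesAlgebra I') (Localization.AtPrime 𝔫')).comp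
        (algebraMap A' (extReesAlgebra I'))).comp (algebraMap Γ(Y, U) A') :=
    RingHom.ext fun a => hgbase a
  have hJ : ∀ K : Y.IdealSheafData, (((K.ideal U).map (algebraMap Γ(Y, U) (R'.sectionsRing U))).map
      (algebraMap (R'.sectionsRing U) (Localization.AtPrime q.asIdeal))).map
      (g : Localization.AtPrime q.asIdeal →+* Localization.AtPrime 𝔫') =
      (((K.ideal U).map (algebraMap Γ(Y, U) A')).map (algebraMap A' (extReesAlgebra I'))).map
        (algebraMap (extReesAlgebra I') (Localization.AtPrime 𝔫')) := fun K => by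
    rw [Ideal.map_map, Ideal.map_map, hcomp, ← Ideal.map_map, ← Ideal.map_map]
  -- (I) on the game side, stated verbatim as in the conclusion (syntactic final assembly)
  have hA := fun K : Y.IdealSheafData =>
    @map_iSup_colon_singleton_pow_of_ringEquiv (Localization.AtPrime q.asIdeal) _ (Localization.AtPrime 𝔫') _ g
      _ _ (hJ K) _ _ hgtInv
  have hB : ∀ K : Y.IdealSheafData, (stalkIdeal (R'.strictTransformPlus K) (φ x)).map
      ((Ψ₀.trans g : (R'.plus : Scheme.{0}).presheaf.stalk (φ x) ≃+* Localization.AtPrime 𝔫') :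
        (R'.plus : Scheme.{0}).presheaf.stalk (φ x) →+* Localization.AtPrime 𝔫') =
      ⨆ n : ℕ, ((((K.ideal U).map (algebraMap Γ(Y, U) A')).map (algebraMap A' (extReesAlgebra I'))).map
        (algebraMap (extReesAlgebra I') (Localization.AtPrime 𝔫'))).colon
        {algebraMap (extReesAlgebra I') (Localization.AtPrime 𝔫') (extReesAlgebra.tInv I') ^ n} := fun K =>
    -- (term-level composition: generic `[CommRing]`-binder lemmas applied to equivalences into
    -- `Localization.AtPrime _` force prohibitively expensive instance unifications)
    (Ideal.map_map (Ψ₀ : (R'.plus : Scheme.{0}).presheaf.stalk (φ x) →+* Localization.AtPrime q.asIdeal)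
      (g : Localization.AtPrime q.asIdeal →+* Localization.AtPrime 𝔫')).symm.trans
      ((congrArg (Ideal.map (g : Localization.AtPrime q.asIdeal →+* Localization.AtPrime 𝔫')) (hΨ₀ K)).trans (hA K))
  have hV : ¬ extReesAlgebra.vertexIdeal I' ≤ 𝔫' := by
    rw [hgvert]
    exact not_irrelevant_le_of_plusChart R' U x q hq
  have hM : (maximalIdeal A').map (algebraMap A' (extReesAlgebra I')) ≤ 𝔫' := by
    rw [← IsLocalization.AtPrime.map_eq_maximalIdeal 𝔮 A', hgprime 𝔮, Ideal.map_le_iff_le_comap, h𝔮]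
  exact ⟨𝔫', h𝔫', Ψ₀.trans g, hB, hV, hM, hgT⟩

end GameSideChart

/-! ## Chart-free forms at a point of `B₊` over an affine open -/

section Pointwise

variable {Y : Scheme.{0}} (R' : ReesFiltration Y) (U : Y.affineOpens)

/-- **K4-E, GAME-SIDE FORM (point version).**  For a point `y'` of `B₊` with base point `y = σ₊(y') ∈ U = Spec A`, the model
`A' = A_{𝔮_y}` of `𝒪_{Y,y}` used by the assembly dictionaries (`Localization.AtPrime (U.2.primeIdealOf ⟨y, _⟩).asIdeal`) and the
localised pieces `I'ₙ = 𝒥ₙ(U) A'`: a prime `𝔫'` of `extReesAlgebra I'` off the vertex and over the closed point of `A'`, and a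
ring isomorphism `Ψ : 𝒪_{B₊, y'} ≃+* (extReesAlgebra I')_{𝔫'}` carrying, for every ideal sheaf `K` on `Y`, the stalk of
`σˢ(K)|_{B₊}` onto `⋃ₙ (K(U) · (extReesAlgebra I')_{𝔫'} : (t⁻¹/1)ⁿ)`. [cite: Wlodarczyk2022, Def. 5.1.1; 3.3.12] -/
theorem exists_gameSide_stalk_model [IsLocallyNoetherian R'.cobordantBlowup]
    (y' : (R'.plus : Scheme.{0})) (hy : R'.πPlus y' ∈ (U : Y.Opens))
    {I' : ℕ → Ideal (Localization.AtPrime (U.2.primeIdealOf ⟨R'.πPlus y', hy⟩).asIdeal)}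
    (hI' : ∀ n, I' n = ((R'.ideal n).ideal U).map
      (algebraMap Γ(Y, U) (Localization.AtPrime (U.2.primeIdealOf ⟨R'.πPlus y', hy⟩).asIdeal))) :
    ∃ (𝔫' : Ideal (extReesAlgebra I')) (_ : 𝔫'.IsPrime)
      (Ψ : (R'.plus : Scheme.{0}).presheaf.stalk y' ≃+* Localization.AtPrime 𝔫'),
      (∀ K : Y.IdealSheafData,
        (stalkIdeal (R'.strictTransformPlus K) y').map
            (Ψ : (R'.plus : Scheme.{0}).presheaf.stalk y' →+* Localization.AtPrime 𝔫') =
          ⨆ n : ℕ, ((((K.ideal U).map (algebraMap Γ(Y, U)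
              (Localization.AtPrime (U.2.primeIdealOf ⟨R'.πPlus y', hy⟩).asIdeal))).map
              (algebraMap _ (extReesAlgebra I'))).map (algebraMap (extReesAlgebra I') (Localization.AtPrime 𝔫'))).colon
            {algebraMap (extReesAlgebra I') (Localization.AtPrime 𝔫') (extReesAlgebra.tInv I') ^ n}) ∧
      ¬ extReesAlgebra.vertexIdeal I' ≤ 𝔫' ∧
      (maximalIdeal (Localization.AtPrime (U.2.primeIdealOf ⟨R'.πPlus y', hy⟩).asIdeal)).map
        (algebraMap _ (extReesAlgebra I')) ≤ 𝔫' := by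
  -- (`obtain` directly on these existentials is prohibitively slow to elaborate here; go through `have`)
  have hφ0 := exists_plusChartFac R' U
  obtain ⟨φ, hφo, hφ⟩ := hφ0
  have hx0 := exists_plusChartFac_apply_eq R' U φ hφ y' hy
  obtain ⟨x, rfl⟩ := hx0
  have hq0 : ∃ q : PrimeSpectrum (R'.sectionsRing U), (R'.plusChart U).ι x = q := ⟨_, rfl⟩
  obtain ⟨q, hq⟩ := hq0
  haveI : q.asIdeal.IsPrime := q.isPrime
  have h𝔮 := (primeIdealOf_πPlus_plusChartFac_asIdeal R' U φ hφ x q hq).symm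
  have hm := exists_gameSide_stalk_model_of_plusChartFac R' U φ hφ x q hq _ h𝔮 hI'
  obtain ⟨𝔫', h𝔫', Ψ, hΨ, hvert, hbase, -⟩ := hm
  exact ⟨𝔫', h𝔫', Ψ, hΨ, hvert, hbase⟩

/-- **K4-E READ-OFF at a point** (for the two halves of [S6]).  Same data, with `X' := σˢ(X)|_{B₊}` locally principal,
`X(U) = (F)` and `B₊ → Spec k` smooth: in addition to the model `(𝔫', Ψ)` there is a generator `γ` of the `t⁻¹`-saturation
`Sat = ⋃ₙ ((F/1) : (t⁻¹/1)ⁿ) ⊆ O' := (extReesAlgebra I')_{𝔫'}` with `(X'_{y'}) Ψ = (γ) = Sat`, `O'` a regular local ring,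
`iotaAt ι X' y' = ι(O', γ) = ι(S, e γ)` ((c6); `γ := Ψ (localGenerator X' y')`; the second form for ANY further ring
isomorphism `e : O' ≃+* S`) and `y' ∈ singImage X' → e γ ∈ 𝔪_S²` for any `e : O' ≃+* S` of local rings (take `e := RingEquiv.refl _`
for `O'` itself; stated over a generic `S` so that every instance in it derives from the `CommRing S` binder — the spelling
generic transport lemmas produce; Matsumura 14.2 via the assembly's point dictionary). [cite: Wlodarczyk2022, 3.3.12; Matsumura1987, Thm. 14.2] -/
theorem exists_gameSide_readOff (ι : (R : Type) → [CommRing R] → R → Ordinal.{0}) (hc6 : IotaIsoInvariant ι)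
    {k : Type} [Field k] (f : Y ⟶ Spec (.of k)) [IsLocallyNoetherian R'.cobordantBlowup] [Smooth (R'.πPlus ≫ f)]
    (X : Y.IdealSheafData) (hlp' : IsLocallyPrincipal (R'.strictTransformPlus X))
    {F : Γ(Y, U)} (hF : X.ideal U = Ideal.span {F})
    (y' : (R'.plus : Scheme.{0})) (hy : R'.πPlus y' ∈ (U : Y.Opens))
    {I' : ℕ → Ideal (Localization.AtPrime (U.2.primeIdealOf ⟨R'.πPlus y', hy⟩).asIdeal)}
    (hI' : ∀ n, I' n = ((R'.ideal n).ideal U).map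
      (algebraMap Γ(Y, U) (Localization.AtPrime (U.2.primeIdealOf ⟨R'.πPlus y', hy⟩).asIdeal))) :
    ∃ (𝔫' : Ideal (extReesAlgebra I')) (_ : 𝔫'.IsPrime)
      (Ψ : (R'.plus : Scheme.{0}).presheaf.stalk y' ≃+* Localization.AtPrime 𝔫') (γ : Localization.AtPrime 𝔫'),
      IsRegularLocalRing (Localization.AtPrime 𝔫') ∧
      (stalkIdeal (R'.strictTransformPlus X) y').map
          (Ψ : (R'.plus : Scheme.{0}).presheaf.stalk y' →+* Localization.AtPrime 𝔫') = Ideal.span {γ} ∧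
      Ideal.span {γ} = ⨆ n : ℕ, (Ideal.span {algebraMap (extReesAlgebra I') (Localization.AtPrime 𝔫')
          (algebraMap _ (extReesAlgebra I') (algebraMap Γ(Y, U)
            (Localization.AtPrime (U.2.primeIdealOf ⟨R'.πPlus y', hy⟩).asIdeal) F))}).colon
          {algebraMap (extReesAlgebra I') (Localization.AtPrime 𝔫') (extReesAlgebra.tInv I') ^ n} ∧
      iotaAt ι (R'.strictTransformPlus X) y' = ι (Localization.AtPrime 𝔫') γ ∧
      (∀ (S : Type) [CommRing S] (e : Localization.AtPrime 𝔫' ≃+* S), iotaAt ι (R'.strictTransformPlus X) y' = ι S (e γ)) ∧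
      (∀ (S : Type) [CommRing S] [IsLocalRing S] (e : Localization.AtPrime 𝔫' ≃+* S),
        y' ∈ singImage (R'.strictTransformPlus X) → e γ ∈ maximalIdeal S ^ 2) ∧
      ¬ extReesAlgebra.vertexIdeal I' ≤ 𝔫' ∧
      (maximalIdeal (Localization.AtPrime (U.2.primeIdealOf ⟨R'.πPlus y', hy⟩).asIdeal)).map
        (algebraMap _ (extReesAlgebra I')) ≤ 𝔫' := by
  have hm := exists_gameSide_stalk_model R' U y' hy hI'
  obtain ⟨𝔫', h𝔫', Ψ, hΨ, hvert, hbase⟩ := hm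
  -- `O'` is a regular local ring: `B₊` is smooth over `k`
  haveI : IsRegularLocalRing ((R'.plus : Scheme.{0}).presheaf.stalk y') :=
    isRegularLocalRing_stalk_of_smooth_of_field (R'.πPlus ≫ f) y'
  haveI hreg : IsRegularLocalRing (Localization.AtPrime 𝔫') := IsRegularLocalRing.of_ringEquiv Ψ
  -- the stalk of the strict transform is principal; `γ := Ψ (local generator)`
  have hpr : ∃ g₀ : (R'.plus : Scheme.{0}).presheaf.stalk y',
      stalkIdeal (R'.strictTransformPlus X) y' = Ideal.span {g₀} := (hlp' y').isPrincipal_stalkIdeal.principal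
  have hlg := stalkIdeal_eq_span_localGenerator (R'.strictTransformPlus X) y' hpr
  -- `γ := Ψ (local generator)` (applied as a ring map, the spelling `Ideal.map_span` produces)
  have e1 := ideal_map_span_singleton
    (Ψ : (R'.plus : Scheme.{0}).presheaf.stalk y' →+* Localization.AtPrime 𝔫') (localGenerator (R'.strictTransformPlus X) y')
  have hγ : (stalkIdeal (R'.strictTransformPlus X) y').map
      (Ψ : (R'.plus : Scheme.{0}).presheaf.stalk y' →+* Localization.AtPrime 𝔫') =
      Ideal.span {(Ψ : (R'.plus : Scheme.{0}).presheaf.stalk y' →+* Localization.AtPrime 𝔫')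
        (localGenerator (R'.strictTransformPlus X) y')} :=
    (congrArg (Ideal.map (Ψ : (R'.plus : Scheme.{0}).presheaf.stalk y' →+* Localization.AtPrime 𝔫')) hlg).trans e1
  -- `Sat` with the single generator `F/1` of `X(U) A'` pushed through the structure maps
  have hJ1 : (X.ideal U).map (algebraMap Γ(Y, U)
        (Localization.AtPrime (U.2.primeIdealOf ⟨R'.πPlus y', hy⟩).asIdeal)) =
      Ideal.span {algebraMap Γ(Y, U) (Localization.AtPrime (U.2.primeIdealOf ⟨R'.πPlus y', hy⟩).asIdeal) F} := by
    rw [hF]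
    exact ideal_map_span_singleton _ F
  have hJ2 := (congrArg (Ideal.map (algebraMap
      (Localization.AtPrime (U.2.primeIdealOf ⟨R'.πPlus y', hy⟩).asIdeal) (extReesAlgebra I'))) hJ1).trans
    (ideal_map_span_singleton _ _)
  have hJ3 := (congrArg (Ideal.map (algebraMap (extReesAlgebra I') (Localization.AtPrime 𝔫'))) hJ2).trans
    (ideal_map_span_singleton _ _)
  have hSat := (hγ.symm.trans (hΨ X)).trans (congrArg (fun J : Ideal (Localization.AtPrime 𝔫') =>
    ⨆ n : ℕ, J.colon {algebraMap (extReesAlgebra I') (Localization.AtPrime 𝔫') (extReesAlgebra.tInv I') ^ n}) hJ3)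
  -- the ring-map spelling and the equivalence spelling of `γ` agree
  have hcoe : (Ψ : (R'.plus : Scheme.{0}).presheaf.stalk y' →+* Localization.AtPrime 𝔫')
      (localGenerator (R'.strictTransformPlus X) y') = Ψ (localGenerator (R'.strictTransformPlus X) y') := rfl
  -- READ-OFF 1: `ι` through `Ψ` ((c6))
  have hι : iotaAt ι (R'.strictTransformPlus X) y' = ι (Localization.AtPrime 𝔫')
      ((Ψ : (R'.plus : Scheme.{0}).presheaf.stalk y' →+* Localization.AtPrime 𝔫')
        (localGenerator (R'.strictTransformPlus X) y')) := by
    rw [hcoe]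
    exact (hc6 ((R'.plus : Scheme.{0}).presheaf.stalk y') (Localization.AtPrime 𝔫') Ψ
      (localGenerator (R'.strictTransformPlus X) y')).symm
  -- READ-OFF 1, generic form: along any further `e : O' ≃+* S` ((c6) for `Ψ ≫ e`)
  have hι' : ∀ (S : Type) [CommRing S] (e : Localization.AtPrime 𝔫' ≃+* S), iotaAt ι (R'.strictTransformPlus X) y' =
      ι S (e ((Ψ : (R'.plus : Scheme.{0}).presheaf.stalk y' →+* Localization.AtPrime 𝔫')
        (localGenerator (R'.strictTransformPlus X) y'))) := fun S _ e =>
    (hc6 ((R'.plus : Scheme.{0}).presheaf.stalk y') S (Ψ.trans e) (localGenerator (R'.strictTransformPlus X) y')).symm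
  -- READ-OFF 2: a point of the non-regular locus has its local equation in `𝔪²` (Matsumura 14.2, point dictionary on `B₊`),
  -- transported along `Ψ ≫ e` by the generic transport lemma (all instances from the `CommRing S` binder)
  have hsq : ∀ (S : Type) [CommRing S] [IsLocalRing S] (e : Localization.AtPrime 𝔫' ≃+* S),
      y' ∈ singImage (R'.strictTransformPlus X) →
      e ((Ψ : (R'.plus : Scheme.{0}).presheaf.stalk y' →+* Localization.AtPrime 𝔫')
        (localGenerator (R'.strictTransformPlus X) y')) ∈ maximalIdeal S ^ 2 := fun S _ _ e hs =>
    map_mem_pow_maximalIdeal_of_ringEquiv (R := (R'.plus : Scheme.{0}).presheaf.stalk y') (S := S) (Ψ.trans e)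
      ((mem_singImage_iff_mem_sq_of_stalkIdeal_eq (R'.strictTransformPlus X) hlg
        (ne_zero_of_mem_singImage_of_stalkIdeal_eq (R'.strictTransformPlus X) hlg hs)).mp hs)
  exact ⟨𝔫', h𝔫', Ψ, _, hreg, hγ, hSat, hι, hι', hsq, hvert, hbase⟩

end Pointwise

end Summit.ResolutionOfSingularities.ResolutionOfSingularities.Cruxes.HypersurfaceCentreConstruction.LocalEngine

end
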